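import Summits.QuantumFields.BalabanUV.T4Continuum.Support.RegionFaceFluxPoincare
import Summits.QuantumFields.BalabanUV.T4Continuum.Support.RegionInteriorGaffney
import Summits.QuantumFields.BalabanUV.T4Continuum.Support.RegionGaugeOrbit
import Summits.QuantumFields.BalabanUV.T4Continuum.Support.RegionGaugeSliceOrthRegion

/-!
# T⁴ programme, spine node NE2 (U1a), sub-row Δ1 «NE2⁰-Dirichlet» — THE ORBIT INEQUALITY BY THE COULOMB REPRESENTATIVE and
# W1 (`SliceCoercive`, ONE constant for all levels) ON EVERY `AtMostOneNeighbour` REGION — in particular on every COORDINATE BOX —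
# MODULO the tent-vs-face comparison

Row NE2 OWNER item O14-a «Δ1-VEC-W1-BOX» (unit `b2b-balaban-t4-ne2-p1`, gen 14; R30 (c), journal 2026-08-20 l.19379 / l.19654), file 3
(assembly).  Inputs BY NAME: file 1 `Support/RegionFaceFlux` (p232334: face-flux field `Φ = faceAvg`, Stokes, `nsq_faceAvg_le_nsq_sub_grad1R`,
tent weights `tentW`), files 2a/2b `Support/RegionFaceFluxChart` / `Support/RegionFaceFluxPoincare` (block Poincaré around face means
`nsq_le_igrad_add_faceAvg`), leaf-07-g7's `Support/RegionInteriorGaffney` («Δ1-VEC-INTERIOR-W2-BOX» F1: `interior_gaffney`, constant 1 under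
`AtMostOneNeighbour`, `interior_gaffney_box` for `IsCoordBox` at `n ≥ 2`), leaf-09-g9's `Support/RegionGaugeOrbit` (`orthSlice_of_gaugePoincare`:
W1 ⟸ the orbit inequality) and leaf-09-g8's `Support/RegionGaugeSliceOrthRegion` (`sliceCoercive_region_of_orthSlice`,
`coercive_regionDeltaA_of_orthSlice`).

 * §1 THE COULOMB REPRESENTATIVE exists for every `A` and every region: `∃ φ, ∂_Ωᴴ∂_Ωφ = ∂_ΩᴴA` (`range (DᴴD) = range Dᴴ`, a rank identity);
   then `B = A − ∂_Ωφ` is region-divergence-free, `curlR B = curlR A`, `avgR B = avgR A − grad₁R (Q′_Ωφ)`.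
 * §2 THE TWO-SCALE TRANSVERSE POINCARÉ inequality, modulo the TENT comparison (displayed shape, §0 below): for `∂_ΩᴴB = 0` and every
   `g : S → ℂ`, **`transversePoincare_of_tent`** `nsq B ≤ (17 + 96C♭)·Σ_μ nsq (igrad_μ B) + 96·n^d·nsq (avgR B − grad₁R g)` — from
   `nsq B ≤ 17ΣI + 12 n^d nsq Φ` (file 2b), `nsq Φ ≤ nsq (Φ − ∂₁g)` (file 1, the face flux is ⊥ coarse Dirichlet gradients),
   `Φ − ∂₁g = (1−Λ)•Φ + (Λ•Φ − QB) + (QB − ∂₁g)` with `|1 − Λ| ≤ ½` absorbed (`nsq Φ ≤ 8·nsq (Λ•Φ − QB) + 8·nsq (QB − ∂₁g)`).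
 * §3 THE ORBIT INEQUALITY on `AtMostOneNeighbour` regions modulo the tent comparison: **`gaugePoincare_of_tent`**
   `∀ A, ∃ φ, nsq (A − ∂_Ωφ) ≤ (17 + 96C♭)·nsq (curlR A) + 96·(n^d·nsq (avgR A))` (Coulomb `φ`, interior Gaffney `ΣI(B) ≤ nsq (curl B)`,
   `g = −Q′_Ωφ` and «Q∂ = ∂₁Q′»).
 * §4 THE ENDs modulo the tent comparison: **`orthSlice_of_tent`**, **`sliceCoercive_of_tent`** (`AtMostOneNeighbour n M S`, `2 ≤ n`, `0 < a`,
   `0 < a′`), **`sliceCoercive_box_of_tent (hS : IsCoordBox M S)`**, **`coercive_regionDeltaA_box_of_tent`** — ONE constant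
   `cW1 d a a′ C♭ = orbitConst d a (17 + 96C♭) 96 / (1 + 4d/σ₀)`, free of `n`, `M`, the box; the level-uniform W1 socket of the owner's star
   towers (`DirichletStarVectorTower.freeTowerLaws_star_of`, `DirichletStarRenormTower.towerLimitRate_star_renorm_of_sq`) and of leaf-07-g7's
   `RegionInteriorW2.towerLimitRate_star_renorm_box_of_slice` on boxes is thereby supplied MODULO the tent comparison.

§0 THE ONE DISPLAYED INPUT (booked supplier item «Δ1-VEC-W1-BOX-TENT», journal l.19654; parametric shape, no `def … : Prop` fact):
`TentComparison n M S C♭ := ∀ B, n^d·nsq (avgR B − Λ•Φ(B)) ≤ C♭·Σ_μ nsq (igrad_μ B)` — Bałaban's line average of a star-bond field against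
the tent-weighted face flux, charged to interior `ν`-differences (column chart of the double block; `Λ = 1` on unit bonds with both ends in
`S`, `λ_n = (n+1)/(2n)` on boundary unit bonds where `Q` sees half a tent).  Elementary and local; to be discharged in a sibling file.

HONEST FRAMING (T4-DAG p. 1).  [folklore] finite lattice calculus + linear algebra on the cell's typed `U = 1` objects; model level (one
region, one averaging scale, finite torus); crude constants (ours); nothing printed is a hypothesis or a conclusion; W1 on boxes holds
MODULO the displayed tent comparison (not yet in the tree); W1 on general unions OPEN (interior Gaffney fails at re-entrant corners); NE2
(U1a) NOT proved; spine PROVED 0/9 unchanged; NOT [B9] (3.16)/(3.23)–(3.27) as printed; NOT infinite volume / mass gap / Clay.  HONEST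
DEPENDENCY: continuum YM on T⁴ ⇐ BetaPertH ∧ nine spine estimates (0/9 proved); BetaPertH ⇐ (D1) ∧ (D4) ∧ CAP+tail; G-an2-4 gates asym, D1
and NE2/3/4.  No `sorry`.
-/

noncomputable section

open scoped BigOperators ComplexConjugate Matrix ComplexOrder
open Finset

namespace Summit.QuantumFields.BalabanUV.T4Continuum.RegionGaugePoincareBox

open Literature.MathematicalPhysics.QuantumFieldTheory.Balaban1983to89.B5Prop11Plancherel (Tor fine unitVec)
open Literature.MathematicalPhysics.QuantumFieldTheory.Balaban1983to89.B5Prop11Lower (nsq nsq_nonneg)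
open Summit.QuantumFields.BalabanUV.T4Continuum
open Summit.QuantumFields.BalabanUV.T4Continuum.SubtypeCompression (Coercive)
open Summit.QuantumFields.BalabanUV.T4Continuum.ScalarBlockPoincare (nsq_add_le)
open Summit.QuantumFields.BalabanUV.T4Continuum.ScalarAveragedPropagator (gammaPs)
open Summit.QuantumFields.BalabanUV.T4Continuum.ScalarAveragedCompression (sigma0 sigma0_pos)
open Summit.QuantumFields.BalabanUV.T4Continuum.RegionGaugeSlice (SliceCoercive)
open Summit.QuantumFields.BalabanUV.T4Continuum.RegionGaugeSliceOrth (OrthSliceCoercive)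
open Summit.QuantumFields.BalabanUV.T4Continuum.RegionScalarCompression (QOm GOm)
open Summit.QuantumFields.BalabanUV.T4Continuum.RegionGaugeFixedVector (starReg curlR gradR avgR grad₁R regionDeltaA curlR_mul_gradR avgR_mul_gradR)
open Summit.QuantumFields.BalabanUV.T4Continuum.RegionGaugeSliceOrthRegion (sliceCoercive_region_of_orthSlice coercive_regionDeltaA_of_orthSlice)
open Summit.QuantumFields.BalabanUV.T4Continuum.RegionGaugeOrbit (orbitConst orbitConst_pos orthSlice_of_gaugePoincare)
open Summit.QuantumFields.BalabanUV.T4Continuum.RegionStarBoundaryCharges (AtMostOneNeighbour atMostOneNeighbour_of_isCoordBox)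
open Summit.QuantumFields.BalabanUV.T4Continuum.RegionInteriorGaffney (interior_gaffney)
open Summit.QuantumFields.BalabanUV.T4Continuum.DirichletStarRenormTower (igrad)
open Summit.QuantumFields.BalabanUV.T4Continuum.RegionFaceFlux (faceAvg tentW abs_one_sub_tentW_le nsq_faceAvg_le_nsq_sub_grad1R)
open Summit.QuantumFields.BalabanUV.T4Continuum.RegionFaceFluxPoincare (nsq_le_igrad_add_faceAvg)
open Summit.QuantumFields.BalabanUV.Beta.GAN24.DirichletBoxTrace (blockReg)
open Summit.QuantumFields.BalabanUV.Beta.GAN24.DirichletBoxTwoLevel (IsCoordBox)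

variable {d : ℕ} (n : ℕ) [NeZero n] (M : Fin d → ℕ) [hM : ∀ μ, NeZero (M μ)] (a a' : ℝ) (S : Tor M → Prop) [DecidablePred S]

/-! ## §0 The displayed tent comparison (parametric shape) -/

/-- **THE TENT-vs-FACE COMPARISON** (parametric shape predicate in the constant `C♭`, like `SliceCoercive`; NOT a fact): for every star-bond
field, `n^d·nsq (avgR B − Λ•Φ(B)) ≤ C♭·Σ_μ nsq (igrad_μ B)`.  Booked supplier item «Δ1-VEC-W1-BOX-TENT». [folklore] -/
def TentComparison (Cf : ℝ) : Prop :=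
  ∀ B : {b // starReg n M S b} → ℂ,
    (n : ℝ) ^ d * nsq (fun i => (avgR n M S *ᵥ B) i - ((tentW n M S i : ℝ) : ℂ) * (faceAvg n M S *ᵥ B) i)
      ≤ Cf * ∑ μ, nsq (igrad M S n μ B)

/-! ## §1 The Coulomb representative -/

omit hM in
/-- **`range (DᴴD) = range Dᴴ`**: the normal equations `DᴴD φ = Dᴴ A` are solvable for every complex matrix `D`. [folklore] -/
theorem exists_normal_solution {m k : Type*} [Fintype m] [Fintype k] [DecidableEq k] (D : Matrix m k ℂ) (A : m → ℂ) :
    ∃ φ : k → ℂ, (Dᴴ * D) *ᵥ φ = Dᴴ *ᵥ A := by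
  have hle : LinearMap.range (Dᴴ * D).mulVecLin ≤ LinearMap.range Dᴴ.mulVecLin := by
    rw [Matrix.mulVecLin_mul]
    exact LinearMap.range_comp_le_range _ _
  have hrk : Module.finrank ℂ (LinearMap.range (Dᴴ * D).mulVecLin) = Module.finrank ℂ (LinearMap.range Dᴴ.mulVecLin) := by
    change (Dᴴ * D).rank = Dᴴ.rank
    rw [Matrix.rank_conjTranspose_mul_self, Matrix.rank_conjTranspose]
  have heq : LinearMap.range (Dᴴ * D).mulVecLin = LinearMap.range Dᴴ.mulVecLin := Submodule.eq_of_le_of_finrank_eq hle hrk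
  have hmem : Dᴴ *ᵥ A ∈ LinearMap.range Dᴴ.mulVecLin := ⟨A, rfl⟩
  rw [← heq] at hmem
  obtain ⟨φ, hφ⟩ := hmem
  exact ⟨φ, hφ⟩

/-- **THE COULOMB REPRESENTATIVE**: every star-bond field is `A = ∂_Ωφ + B` with `∂_ΩᴴB = 0`. [folklore] -/
theorem exists_coulomb (A : {b // starReg n M S b} → ℂ) :
    ∃ φ : {x // blockReg n M S x} → ℂ, (gradR n M S)ᴴ *ᵥ (A - gradR n M S *ᵥ φ) = 0 := by
  obtain ⟨φ, hφ⟩ := exists_normal_solution (gradR n M S) A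
  refine ⟨φ, ?_⟩
  rw [Matrix.mulVec_sub, Matrix.mulVec_mulVec, hφ, sub_self]

/-- the transverse part has the same curl. [folklore] -/
theorem curlR_sub_gradR (A : {b // starReg n M S b} → ℂ) (φ : {x // blockReg n M S x} → ℂ) :
    curlR n M S *ᵥ (A - gradR n M S *ᵥ φ) = curlR n M S *ᵥ A := by
  rw [Matrix.mulVec_sub, Matrix.mulVec_mulVec, curlR_mul_gradR, Matrix.zero_mulVec, sub_zero]

/-- its line averages differ from those of `A` by a coarse Dirichlet gradient («Q∂ = ∂₁Q′»). [folklore] -/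
theorem avgR_sub_gradR (A : {b // starReg n M S b} → ℂ) (φ : {x // blockReg n M S x} → ℂ) :
    avgR n M S *ᵥ (A - gradR n M S *ᵥ φ) - grad₁R M S *ᵥ (-(QOm n M S *ᵥ φ)) = avgR n M S *ᵥ A := by
  rw [Matrix.mulVec_sub, Matrix.mulVec_mulVec, avgR_mul_gradR, ← Matrix.mulVec_mulVec, Matrix.mulVec_neg]
  abel

/-! ## §2 The two-scale transverse Poincaré inequality modulo the tent comparison -/

omit [NeZero n] hM [DecidablePred S] in
/-- pointwise-weighted fields: `nsq (c•v) ≤ K·nsq v` when `|c i|² ≤ K`. [folklore] -/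
theorem nsq_weight_le {ι : Type*} [Fintype ι] (c : ι → ℝ) (v : ι → ℂ) {K : ℝ} (hK : ∀ i, c i ^ 2 ≤ K) :
    nsq (fun i => ((c i : ℝ) : ℂ) * v i) ≤ K * nsq v := by
  unfold nsq
  rw [Finset.mul_sum]
  refine Finset.sum_le_sum fun i _ => ?_
  rw [norm_mul, mul_pow, Complex.norm_real, Real.norm_eq_abs, sq_abs]
  exact mul_le_mul_of_nonneg_right (hK i) (by positivity)

/-- **THE FACE FLUX IS CONTROLLED MODULO COARSE GRADIENTS**: for `∂_ΩᴴB = 0` and every `g : S → ℂ`,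
`nsq Φ(B) ≤ 8·nsq (avgR B − Λ•Φ(B)) + 8·nsq (avgR B − ∂₁g)` (orthogonality + `|1 − Λ| ≤ ½` absorbed). [folklore] -/
theorem nsq_faceAvg_le (B : {b // starReg n M S b} → ℂ) (hB : (gradR n M S)ᴴ *ᵥ B = 0) (g : {y // S y} → ℂ) :
    nsq (faceAvg n M S *ᵥ B)
      ≤ 8 * nsq (fun i => (avgR n M S *ᵥ B) i - ((tentW n M S i : ℝ) : ℂ) * (faceAvg n M S *ᵥ B) i)
        + 8 * nsq (avgR n M S *ᵥ B - grad₁R M S *ᵥ g) := by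
  set F := faceAvg n M S *ᵥ B with hF
  set Q := avgR n M S *ᵥ B with hQ
  set G := grad₁R M S *ᵥ g with hG
  set u : (Tor M × Fin d) → ℂ := fun i => ((1 - tentW n M S i : ℝ) : ℂ) * F i with hu
  set v : (Tor M × Fin d) → ℂ := fun i => Q i - ((tentW n M S i : ℝ) : ℂ) * F i with hv
  have h1 : nsq F ≤ nsq (F - G) := nsq_faceAvg_le_nsq_sub_grad1R n M S B hB g
  have hdec : F - G = u + (-v + (Q - G)) := by
    funext i
    simp only [hu, hv, Pi.sub_apply, Pi.add_apply, Pi.neg_apply, Complex.ofReal_sub, Complex.ofReal_one]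
    ring
  have hu2 : nsq u ≤ (1 / 4) * nsq F := by
    refine nsq_weight_le (fun i => 1 - tentW n M S i) F fun i => ?_
    have h := abs_one_sub_tentW_le n M S i
    have h' : (1 - tentW n M S i) ^ 2 = |1 - tentW n M S i| ^ 2 := (sq_abs _).symm
    rw [h']
    nlinarith [abs_nonneg (1 - tentW n M S i)]
  have hneg : nsq (-v) = nsq v := by unfold nsq; simp
  have h2 : nsq (F - G) ≤ 2 * nsq u + 2 * (2 * nsq v + 2 * nsq (Q - G)) := by
    rw [hdec]
    refine (nsq_add_le u _).trans ?_
    have := nsq_add_le (-v) (Q - G)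
    rw [hneg] at this
    linarith
  linarith

/-- **THE TWO-SCALE TRANSVERSE POINCARÉ INEQUALITY modulo the tent comparison**: for `∂_ΩᴴB = 0` and every `g : S → ℂ`,
`nsq B ≤ (17 + 96C♭)·Σ_μ nsq (igrad_μ B) + 96·(n^d·nsq (avgR B − ∂₁g))`. [folklore] -/
theorem transversePoincare_of_tent {Cf : ℝ} (hT : TentComparison n M S Cf) (B : {b // starReg n M S b} → ℂ)
    (hB : (gradR n M S)ᴴ *ᵥ B = 0) (g : {y // S y} → ℂ) :
    nsq B ≤ (17 + 96 * Cf) * ∑ μ, nsq (igrad M S n μ B) + 96 * ((n : ℝ) ^ d * nsq (avgR n M S *ᵥ B - grad₁R M S *ᵥ g)) := by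
  have hnd : (0 : ℝ) ≤ (n : ℝ) ^ d := by positivity
  have h1 := nsq_le_igrad_add_faceAvg n M S B
  have h2 := nsq_faceAvg_le n M S B hB g
  have h3 := hT B
  have h4 : (n : ℝ) ^ d * nsq (faceAvg n M S *ᵥ B)
      ≤ 8 * (Cf * ∑ μ, nsq (igrad M S n μ B)) + 8 * ((n : ℝ) ^ d * nsq (avgR n M S *ᵥ B - grad₁R M S *ᵥ g)) := by
    have := mul_le_mul_of_nonneg_left h2 hnd
    linarith
  linarith

/-! ## §3 The orbit inequality on `AtMostOneNeighbour` regions modulo the tent comparison -/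

/-- **THE ORBIT INEQUALITY BY THE COULOMB REPRESENTATIVE**: on a region where every exterior site has at most one neighbour in `Ω`
(leaf-07-g7's `AtMostOneNeighbour`; every coordinate box at `n ≥ 2`), every star-bond field admits a Dirichlet scalar `φ` with
`nsq (A − ∂_Ωφ) ≤ (17 + 96C♭)·nsq (curlR A) + 96·(n^d·nsq (avgR A))`. [folklore] -/
theorem gaugePoincare_of_tent (hH : AtMostOneNeighbour n M S) {Cf : ℝ} (hCf : 0 ≤ Cf) (hT : TentComparison n M S Cf)
    (A : {b // starReg n M S b} → ℂ) :
    ∃ φ : {x // blockReg n M S x} → ℂ,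
      nsq (A - gradR n M S *ᵥ φ) ≤ (17 + 96 * Cf) * nsq (curlR n M S *ᵥ A) + 96 * ((n : ℝ) ^ d * nsq (avgR n M S *ᵥ A)) := by
  obtain ⟨φ, hB⟩ := exists_coulomb n M S A
  refine ⟨φ, ?_⟩
  set B := A - gradR n M S *ᵥ φ with hBdef
  have hI : ∑ μ, nsq (igrad M S n μ B) ≤ nsq (curlR n M S *ᵥ A) := by
    have h := interior_gaffney n M S hH B
    rw [hB, curlR_sub_gradR] at h
    have : nsq (0 : {x // blockReg n M S x} → ℂ) = 0 := by simp [nsq]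
    rw [this, add_zero] at h
    exact h
  have hTP := transversePoincare_of_tent n M S hT B hB (-(QOm n M S *ᵥ φ))
  rw [hBdef, avgR_sub_gradR] at hTP
  have hC : 0 ≤ 17 + 96 * Cf := by positivity
  calc nsq B ≤ (17 + 96 * Cf) * ∑ μ, nsq (igrad M S n μ B) + 96 * ((n : ℝ) ^ d * nsq (avgR n M S *ᵥ A)) := hTP
    _ ≤ (17 + 96 * Cf) * nsq (curlR n M S *ᵥ A) + 96 * ((n : ℝ) ^ d * nsq (avgR n M S *ᵥ A)) := by gcongr

/-! ## §4 The ENDs modulo the tent comparison -/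

/-- the W1 constant: `cW1 d a a′ C♭ = orbitConst d a (17 + 96C♭) 96 / (1 + 4d/σ₀(d,a′))` — free of `n`, the torus and the region. [folklore] -/
def cW1 (d : ℕ) (a a' Cf : ℝ) : ℝ := orbitConst d a (17 + 96 * Cf) 96 / (1 + 4 * d / sigma0 d a')

omit [NeZero n] hM [DecidablePred S] in
/-- `0 < cW1` (`0 < a`, `0 < a′`). [folklore] -/
theorem cW1_pos {Cf : ℝ} (ha : 0 < a) (ha' : 0 < a') : 0 < cW1 d a a' Cf := by
  unfold cW1
  have h1 := orbitConst_pos d (C₁ := 17 + 96 * Cf) (C₂ := 96) ha (by norm_num)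
  have h2 := sigma0_pos (d := d) ha'
  positivity

/-- **THE ORTHOGONAL-SLICE INEQUALITY modulo the tent comparison** on `AtMostOneNeighbour` regions (`2 ≤ n`, `0 < a`). [folklore] -/
theorem orthSlice_of_tent (hH : AtMostOneNeighbour n M S) (hn : 2 ≤ n) (ha : 0 < a) {Cf : ℝ} (hCf : 0 ≤ Cf)
    (hT : TentComparison n M S Cf) :
    OrthSliceCoercive (curlR n M S) (gradR n M S) (QOm n M S) (avgR n M S) (a * (n : ℝ) ^ d) (orbitConst d a (17 + 96 * Cf) 96) :=
  orthSlice_of_gaugePoincare n M a S hn ha (by norm_num) (gaugePoincare_of_tent n M S hH hCf hT)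

/-- **W1 modulo the tent comparison** on `AtMostOneNeighbour` regions: `SliceCoercive … (cW1 d a a′ C♭)` — ONE constant for every level
`n ≥ 2`, every torus, every such region. [folklore] -/
theorem sliceCoercive_of_tent (hH : AtMostOneNeighbour n M S) (hn : 2 ≤ n) (ha : 0 < a) (ha' : 0 < a') {Cf : ℝ} (hCf : 0 ≤ Cf)
    (hT : TentComparison n M S Cf) :
    SliceCoercive (curlR n M S) (gradR n M S) (GOm n M a' S) (QOm n M S) (avgR n M S) (a * (n : ℝ) ^ d) (cW1 d a a' Cf) :=
  sliceCoercive_region_of_orthSlice n M a a' S ha' (orbitConst_pos d ha (by norm_num)).le (orthSlice_of_tent n M a S hH hn ha hCf hT)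

/-- **W1 ON BOXES modulo the tent comparison**: for every COORDINATE-BOX region (`IsCoordBox M S`) at every level `n ≥ 2`. [folklore] -/
theorem sliceCoercive_box_of_tent (hS : IsCoordBox M S) (hn : 2 ≤ n) (ha : 0 < a) (ha' : 0 < a') {Cf : ℝ} (hCf : 0 ≤ Cf)
    (hT : TentComparison n M S Cf) :
    SliceCoercive (curlR n M S) (gradR n M S) (GOm n M a' S) (QOm n M S) (avgR n M S) (a * (n : ℝ) ^ d) (cW1 d a a' Cf) :=
  sliceCoercive_of_tent n M a a' S (atMostOneNeighbour_of_isCoordBox n M S hn hS) hn ha ha' hCf hT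

/-- the same as a COERCIVITY constant of the faithful region operator `Δ_a(Ω₀)` (the owner's W1 socket `Coercive (D k) γ`), uniform in the
level. [folklore] -/
theorem coercive_regionDeltaA_box_of_tent (hS : IsCoordBox M S) (hn : 2 ≤ n) (ha : 0 < a) (ha' : 0 < a') {Cf : ℝ} (hCf : 0 ≤ Cf)
    (hT : TentComparison n M S Cf) :
    Coercive (regionDeltaA n M a a' S)
      (min (orbitConst d a (17 + 96 * Cf) 96 / (1 + 4 * d / sigma0 d a') / 2) (1 / (2 * (gammaPs d a')⁻¹))) :=
  coercive_regionDeltaA_of_orthSlice n M a a' S ha' (orbitConst_pos d ha (by norm_num))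
    (orthSlice_of_tent n M a S (atMostOneNeighbour_of_isCoordBox n M S hn hS) hn ha hCf hT)

end Summit.QuantumFields.BalabanUV.T4Continuum.RegionGaugePoincareBox

end
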